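import Literature.MathematicalPhysics.QuantumFieldTheory.King1986.EffectiveLaplacianRate
import Literature.MathematicalPhysics.QuantumFieldTheory.King1986.AliasingIdentity
import Literature.NumberTheory.LFunctions.RobinOscillation
import HarnessLib

/-!
# King 1986, Lemma 4.2: the composed symbol (4.12) obeys (4.7) — hence (3.91) with explicit constants

**Citation header (reproduction of PUBLISHED work; template file of the Bałaban lattice Yang–Mills
cell `pub-balaban`, TEMPLATE.md §18.6).**
C. King, *The U(1) Higgs model. I. The continuum limit*, Commun. Math. Phys. **102** (1986) 649–677
[King1986], §4 pp. 671–672: the composition law (4.12)–(4.13), **Lemma 4.2** "The operator (4.12)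
satisfies (4.7) and (4.8)" with its proof (4.14)–(4.17), and Lemma 4.3 (4.18) = Proposition 3.10 (3.91)
p. 669.  Page images read: `b2b-balaban-template/king-renders/1986-cmp102-king-u1-higgs-I-p023-x2.png`
(p. 671), `…-p024-x2.png` (p. 672).

**What King proves (verbatim, p. 671).**  "To prove convergence of `Δ^{(k)}(p′)`, we notice that the
composition law for renormalization transformations allows us to write `Δ^{(k+n)}(p′)` in the form
(4.6), with `D⁻¹(p) = a_n⁻¹L^{−2k} + Σ_{l′} |u_n^{η′}(p+l′)|² Δ^{η′}(p+l′)⁻¹`, (4.12) where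
`l′ ∈ 2π(L^k/2)ℤ^d` … Also `u_n^{η′}(p) = Π_{μ=1}^d [η⁻¹(e^{−iηp_μ} − 1) η′(e^{−iη′p_μ} − 1)]`. (4.13)
[sic: the print omits the inverse on the last factor; (4.3) p. 670 has `η(e^{−iηp_μ} − 1)⁻¹`, and the
formulas below are used with the inverse.]
**Lemma 4.2.** The operator (4.12) satisfies (4.7) and (4.8).  *Proof.* `D⁻¹(p) − (|p|² + m²(L^kε)²)⁻¹
= a_n⁻¹L^{−2k} + |u_n^{η′}(p)|²Δ^{η′}(p)⁻¹ − (|p|² + m²(L^kε)²)⁻¹ + Σ_{l′≠0} |u_n^{η′}(p+l′)|²Δ^{η}(p+l′)⁻¹`,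
(4.14) [sic: the last factor is printed `Δ^η`; by (4.12) it is `Δ^{η′}`] when `l′ ≠ 0`, `Δ^{η′}(p+l′) ≥ C|p+l′|² ≥ CL^{2k}`. Therefore `|1 − |u_n^{η′}(p)|²| ≤ … ≤ CL^{−2k}|p|²`.
(4.15) Therefore using (4.7) for `Δ^η(p)` and (4.15),
`|D⁻¹(p) + (|p|² + m²(L^kε)²)⁻¹| ≤ CL^{−2k}{1 + Σ_{l′≠0}|u_n^{η′}(p+l′)|²} ≤ CL^{−2k}`. (4.16)"
[sic: (4.16) prints `+` inside the modulus; it is the difference of (4.14), i.e. (4.7) for `D`.]  (Cross-read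
G-pv05g4-3: the three misprints are now quoted as printed and repaired outside the quotation marks.)

**What is proved here (everything PROVED; no named fact).**  With `N = L^k = η⁻¹` outer fine points per
block side, `R = L^n` the refinement factor (`η′ = (NR)⁻¹`), mass `M = m²(L^kε)² ≥ 0`, and the
cell's real Fourier vocabulary of `Balaban1983to89.B4Strip` (`Sxir`, `uFactorr`, `Ur`, `DeltaXir`,
`shiftr`) for the INNER (refinement) alias sums written in the rescaled variable `y = ηp ∈ [−π,π]^d`:
* §1 elementary inputs: (Weierstrass' product inequality is reused from the tree,
  `Literature.NumberTheory.LFunctions.RobinOscillation.one_sub_sum_le_prod`); the rescaled one-coordinate ratio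
  `|u|²`-factor `ρ_R(y) = S₁(y)/S_ξ(y) ≥ 1 − y²/12` on `|y| ≤ π` (= (4.15) per coordinate, from
  "`x² ≥ sin²x ≥ x² − x⁴/3`"), hence `Ur R 0 y ≥ 1 − |y|²/12`; the FAR-ALIAS bound
  "`Δ^{η′}(p+l′) ≥ C|p+l′|² ≥ CL^{2k}`" in the sharp rescaled form `S_ξ(y_μ + 2πm_μ) ≥ 4` for
  `1 ≤ m_μ ≤ R−1`, hence `DeltaXir R M̃ (y + 2πm) ≥ 4` for every alias `m ≠ 0`;
* §2 `composedInvResc c R M̃ y := c + Σ_{m : Fin d → Fin R} Ur R m y · (DeltaXir R M̃ (y+2πm))⁻¹`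
  (= `N²·D⁻¹(p)` of (4.12) at `y = p/N`, `c = a_n⁻¹`, `M̃ = M/N²`) and **LEMMA 4.2, rescaled**:
  `|composedInvResc c R M̃ y − (|y|² + M̃)⁻¹| ≤ c + π²/48 + 1/3` for `0 < |y|`, `|y_μ| ≤ π` — from
  (4.7) for `Δ^{η′}` (`EffectiveLaplacianRate.latticeSymbol_inv_sub_ref_le`, constant `π²/48`),
  (4.15) (`1 − Ur R 0 y ≤ |y|²/12`), the far-alias bound, and the aliasing identity
  `Σ_m Ur R m y = 1` (`AliasingIdentity.sum_Ur_eq_one`); unscaled: `composedInv`, (4.7) for `D` with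
  the explicit constant `C_D = a_n⁻¹ + π²/48 + 1/3` times `N⁻² = L^{−2k}` (`lemma42`);
* §3 **(3.91) with explicit constants and NO analytic hypothesis left**: for any outer alias data
  (finite set of alias points `q_i` of the `η`-zone `|q_{i,μ}| ≤ πN`, `q_i ≠ 0`, weights `w_i ≥ 0` with
  `Σ w ≤ 1`), with `A_i = Δ^η(q_i)` (`latticeSymbol N⁻¹ M`) and `D_i = D(q_i)` the composed values,
  `|Δ − Δ̄| ≤ 2a·C_D·N⁻²·Δ` (`prop310_rate`; `Δ = effSymbol s a w A`, `Δ̄ = effSymbol s a w D`).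
  The only input NOT proved here is the structural COMPOSITION LAW itself — that King's level-`(k+n)`
  symbol (4.5) EQUALS `effSymbol s a_k w D` with this `D` (alias splitting `l″ = l + l′`,
  multiplicativity of (4.3)/(4.13), `a_{k+n}⁻¹ = a_k⁻¹ + L^{−2k}a_n⁻¹` = `inv_aK_add`): it is the
  definition of "the composed symbol" used below; R1 of the cross-read C-pv23-8 (the hypothesis
  `0 < |p|` of `latticeSymbol_inv_sub_ref_le` is removable) is recorded as `latticeSymbol_inv_sub_ref_le'`.

SCOPE as in `EffectiveLaplacianRate`: A = 0 background, scalar block averaging, free boundary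
conditions; King's paper is `d = 2, 3`, the statements here hold for every `d`.  Nothing in this file
refers to or asserts anything about Bałaban's papers.
-/

noncomputable section

open Finset Real
open Literature.MathematicalPhysics.QuantumFieldTheory.Balaban1983to89

namespace Literature.MathematicalPhysics.QuantumFieldTheory.King1986

/-! ## §0 R1 of C-pv23-8: (4.7) for `Δ^η` without the hypothesis `0 < |p|` -/

variable {d : Type*} [Fintype d]

/-- (4.7) for `Δ^η` on the whole Brillouin zone: at `p = 0` both inverses coincide (`Δ^η(0) = M`).
[cite: King1986, (4.7) and (4.10) p.671] -/
theorem latticeSymbol_inv_sub_ref_le' {η : ℝ} (hη : η ≠ 0) {M : ℝ} (hM : 0 ≤ M) {p : d → ℝ}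
    (hp : ∀ μ, |η * p μ| ≤ π) :
    |(latticeSymbol η M p)⁻¹ - (momSq p + M)⁻¹| ≤ π ^ 2 / 48 * η ^ 2 := by
  rcases lt_or_eq_of_le (momSq_nonneg p) with hpos | hzero
  · exact latticeSymbol_inv_sub_ref_le hη hM hp hpos
  · -- `momSq p = 0` forces `p = 0`, hence `Δ^η(p) = M`
    have hp0 : ∀ μ, p μ = 0 := by
      intro μ
      have h := (Finset.sum_eq_zero_iff_of_nonneg (fun ν _ => sq_nonneg (p ν))).mp hzero.symm μ
        (Finset.mem_univ μ)
      exact pow_eq_zero_iff (n := 2) (by norm_num) |>.mp h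
    have hΔ : latticeSymbol η M p = M := by
      unfold latticeSymbol fdSymbol
      simp [hp0]
    rw [hΔ, ← hzero, zero_add, sub_self, abs_zero]
    positivity

/-! ## §1 Elementary inputs -/

-- Weierstrass' product inequality `1 − Σ t_i ≤ Π (1 − t_i)` (0 ≤ t_i ≤ 1) is already in the tree:
-- `Literature.NumberTheory.LFunctions.RobinOscillation.one_sub_sum_le_prod` (imported, reused below).

/-- `π² < 12` (from `π < 3.15`). [folklore] -/
theorem pi_sq_lt_twelve : π ^ 2 < 12 := by
  have h := Real.pi_lt_d2
  have h0 := Real.pi_pos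
  nlinarith

/-- Bridge: `B4Strip.Sxir R x = fdSymbol R⁻¹ x` (`4R² sin²(x/2R)`). [folklore] -/
theorem Sxir_eq_fdSymbol {R : ℕ} (hR : R ≠ 0) (x : ℝ) :
    B4Strip.Sxir R x = fdSymbol ((R : ℝ)⁻¹) x := by
  rw [B4Strip.Sxir_eq]
  unfold fdSymbol
  have hR' : (R : ℝ) ≠ 0 := by exact_mod_cast hR
  have : (R : ℝ)⁻¹ * x / 2 = x / (2 * R) := by field_simp
  rw [this]
  field_simp

/-- Bridge: `B4Strip.S1r x = fdSymbol 1 x` (`4 sin²(x/2)`). [folklore] -/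
theorem S1r_eq_fdSymbol (x : ℝ) : B4Strip.S1r x = fdSymbol 1 x := by
  rw [B4Strip.S1r_eq]; unfold fdSymbol; simp

variable {dd : ℕ}

/-- Bridge: `B4Strip.DeltaXir R M y = latticeSymbol R⁻¹ M y`. [folklore] -/
theorem DeltaXir_eq_latticeSymbol {R : ℕ} (hR : R ≠ 0) (M : ℝ) (y : Fin dd → ℝ) :
    B4Strip.DeltaXir R M y = latticeSymbol ((R : ℝ)⁻¹) M y := by
  unfold B4Strip.DeltaXir latticeSymbol
  simp_rw [Sxir_eq_fdSymbol hR]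

/-- `B4Strip.shiftr` by the zero alias is the identity. [folklore] -/
theorem shiftr_zero (R : ℕ) [NeZero R] (y : Fin dd → ℝ) :
    B4Strip.shiftr R (fun _ => (0 : Fin R)) y = y := by
  funext μ; simp [B4Strip.shiftr]

/-- (4.15), one coordinate, rescaled (`y = ηp_μ`): the ratio of finite-difference symbols at spacings
`η` and `η′ = η/R`, `ρ_R(y) = S₁(y)/S_ξ(y) = uFactorr R 0 y`, satisfies `1 − y²/12 ≤ ρ_R(y)` on
`|y| ≤ π` — from `4 sin²(y/2) ≥ y² − y⁴/12` and `4R² sin²(y/2R) ≤ y²`.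
[cite: King1986, (4.15) p.671] -/
theorem uFactorr_zero_ge_one_sub {R : ℕ} (hR : 1 ≤ R) {y : ℝ} (hy : |y| ≤ π) :
    1 - y ^ 2 / 12 ≤ B4Strip.uFactorr R 0 y := by
  by_cases hy0 : y = 0
  · subst hy0; rw [uFactorr_zero_left]; simp
  · unfold B4Strip.uFactorr
    simp only [if_true, hy0, if_false]
    have hpos : 0 < B4Strip.Sxir R y := B4Strip.Sxir_pos R hR y hy0 hy
    have hle : B4Strip.Sxir R y ≤ y ^ 2 := B4Strip.Sxir_le R y
    have hnum : y ^ 2 - 1 ^ 2 / 12 * y ^ 4 ≤ B4Strip.S1r y := by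
      rw [S1r_eq_fdSymbol]
      exact fdSymbol_ge_quartic one_ne_zero (by simpa using hy)
    have hy2 : y ^ 2 ≤ π ^ 2 := by
      rw [← sq_abs]; exact pow_le_pow_left₀ (abs_nonneg y) hy 2
    have hnn : 0 ≤ y ^ 2 - y ^ 4 / 12 := by
      have : y ^ 4 = y ^ 2 * y ^ 2 := by ring
      nlinarith [pi_sq_lt_twelve, sq_nonneg y]
    rw [le_div_iff₀ hpos]
    calc (1 - y ^ 2 / 12) * B4Strip.Sxir R y ≤ (1 - y ^ 2 / 12) * y ^ 2 := by
          apply mul_le_mul_of_nonneg_left hle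
          nlinarith [pi_sq_lt_twelve]
      _ = y ^ 2 - 1 ^ 2 / 12 * y ^ 4 := by ring
      _ ≤ B4Strip.S1r y := hnum

/-- (4.15), all coordinates: `1 − |y|²/12 ≤ |u_n^{η′}(p)|² = Ur R 0 y` on the Brillouin zone (product of
the one-coordinate bounds via Weierstrass). [cite: King1986, (4.15) p.671] -/
theorem Ur_zero_ge_one_sub {R : ℕ} [NeZero R] (hR : 1 ≤ R) {y : Fin dd → ℝ}
    (hy : ∀ μ, |y μ| ≤ π) :
    1 - momSq y / 12 ≤ B4Strip.Ur R (fun _ => (0 : Fin R)) y := by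
  unfold B4Strip.Ur momSq
  have ht0 : ∀ μ ∈ (Finset.univ : Finset (Fin dd)), 0 ≤ y μ ^ 2 / 12 := fun μ _ => by positivity
  have ht1 : ∀ μ ∈ (Finset.univ : Finset (Fin dd)), y μ ^ 2 / 12 ≤ 1 := by
    intro μ _
    have hy2 : y μ ^ 2 ≤ π ^ 2 := by
      rw [← sq_abs]; exact pow_le_pow_left₀ (abs_nonneg _) (hy μ) 2
    nlinarith [pi_sq_lt_twelve]
  have hW := Literature.NumberTheory.LFunctions.RobinOscillation.one_sub_sum_le_prod Finset.univ
    (fun μ => y μ ^ 2 / 12) ht0 ht1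
  rw [Finset.sum_div]
  calc 1 - ∑ μ, y μ ^ 2 / 12 ≤ ∏ μ, (1 - y μ ^ 2 / 12) := hW
    _ ≤ ∏ μ, B4Strip.uFactorr R ((fun _ => (0 : Fin R)) μ : ℕ) (y μ) := by
        apply Finset.prod_le_prod
        · intro μ hμ; linarith [ht1 μ hμ]
        · intro μ _
          simpa using uFactorr_zero_ge_one_sub hR (hy μ)

/-- `sin a ≤ sin x` for `0 ≤ a ≤ π/2` and `a ≤ x ≤ π − a`. [folklore] -/
theorem sin_ge_sin_of_mem {a x : ℝ} (ha0 : 0 ≤ a) (ha : a ≤ π / 2) (h1 : a ≤ x) (h2 : x ≤ π - a) :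
    Real.sin a ≤ Real.sin x := by
  by_cases hx : x ≤ π / 2
  · exact Real.sin_le_sin_of_le_of_le_pi_div_two (by linarith) hx h1
  · push Not at hx
    rw [← Real.sin_pi_sub x]
    exact Real.sin_le_sin_of_le_of_le_pi_div_two (by linarith) (by linarith) (by linarith)

/-- THE FAR-ALIAS BOUND, one coordinate, rescaled: for `1 ≤ m ≤ R − 1` and `|y| ≤ π`,
`S_ξ(y + 2πm) = 4R² sin²((y+2πm)/2R) ≥ 4` ("when `l′ ≠ 0`, `Δ^{η′}(p+l′) ≥ C|p+l′|² ≥ CL^{2k}`", here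
with the sharp constant: the angle lies in `[π/2R, π − π/2R]`, where `sin ≥ sin(π/2R) ≥ 1/R`).
[cite: King1986, (4.14) p.671] -/
theorem Sxir_shift_ge_four {R m : ℕ} (hm1 : 1 ≤ m) (hmR : m + 1 ≤ R) {y : ℝ} (hy : |y| ≤ π) :
    4 ≤ B4Strip.Sxir R (y + 2 * π * m) := by
  rw [B4Strip.Sxir_eq]
  have hR1 : (1 : ℝ) ≤ R := by exact_mod_cast (le_trans (by omega : 1 ≤ m + 1) hmR)
  have hR0 : (0 : ℝ) < R := by linarith
  have hm1' : (1 : ℝ) ≤ m := by exact_mod_cast hm1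
  have hmR' : (m : ℝ) + 1 ≤ R := by exact_mod_cast hmR
  have hπ := Real.pi_pos
  obtain ⟨hyl, hyu⟩ := abs_le.mp hy
  set a := π / (2 * R) with ha
  set α := (y + 2 * π * m) / (2 * R) with hα
  have ha0 : 0 ≤ a := by positivity
  have haπ : a ≤ π / 2 := by
    rw [ha, div_le_div_iff₀ (by positivity) (by positivity)]; nlinarith
  have h1 : a ≤ α := by
    rw [ha, hα]
    have hnum : π ≤ y + 2 * π * m := by nlinarith
    gcongr
  have h2 : α ≤ π - a := by
    rw [hα, ha, div_le_iff₀ (by positivity)]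
    have : (π - π / (2 * R)) * (2 * R) = 2 * π * R - π := by field_simp
    rw [this]; nlinarith
  have hsin : Real.sin a ≤ Real.sin α := sin_ge_sin_of_mem ha0 haπ h1 h2
  have hjordan : (R : ℝ)⁻¹ ≤ Real.sin a := by
    have := Real.mul_le_sin ha0 haπ
    rw [ha] at this ⊢
    calc (R : ℝ)⁻¹ = 2 / π * (π / (2 * R)) := by field_simp
      _ ≤ Real.sin (π / (2 * R)) := this
  have hα1 : (R : ℝ)⁻¹ ≤ Real.sin α := hjordan.trans hsin
  have hinv0 : 0 ≤ (R : ℝ)⁻¹ := by positivity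
  have hsq : (R : ℝ)⁻¹ ^ 2 ≤ Real.sin α ^ 2 := pow_le_pow_left₀ hinv0 hα1 2
  calc (4 : ℝ) = 4 * (R : ℝ) ^ 2 * (R : ℝ)⁻¹ ^ 2 := by field_simp
    _ ≤ 4 * (R : ℝ) ^ 2 * Real.sin α ^ 2 := mul_le_mul_of_nonneg_left hsq (by positivity)

/-- The far-alias bound for the rescaled `d`-dimensional symbol: for an alias `m ≠ 0`,
`DeltaXir R M̃ (y + 2πm) ≥ 4` (`M̃ ≥ 0`, `|y_μ| ≤ π`); i.e. `Δ^{η′}(p+l′) ≥ 4η⁻² = 4L^{2k}`.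
[cite: King1986, (4.14) p.671] -/
theorem DeltaXir_shift_ge_four {R : ℕ} {Mt : ℝ} (hMt : 0 ≤ Mt) {y : Fin dd → ℝ}
    (hy : ∀ μ, |y μ| ≤ π) {m : Fin dd → Fin R} {μ : Fin dd} (hμ : (m μ : ℕ) ≠ 0) :
    4 ≤ B4Strip.DeltaXir R Mt (B4Strip.shiftr R m y) := by
  unfold B4Strip.DeltaXir
  have hterm : 4 ≤ B4Strip.Sxir R (B4Strip.shiftr R m y μ) := by
    simp only [B4Strip.shiftr]
    exact Sxir_shift_ge_four (Nat.one_le_iff_ne_zero.mpr hμ) (by have := (m μ).isLt; omega) (hy μ)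
  have hle : B4Strip.Sxir R (B4Strip.shiftr R m y μ) ≤ ∑ ν, B4Strip.Sxir R (B4Strip.shiftr R m y ν) :=
    Finset.single_le_sum (fun ν _ => B4Strip.Sxir_nonneg R _) (Finset.mem_univ μ)
  linarith

/-! ## §2 The composed symbol (4.12) and Lemma 4.2 -/

/-- The RESCALED composed inverse symbol `N²·D⁻¹(p)` of (4.12) at `y = p/N`:
`c + Σ_{m} Ur R m y · (DeltaXir R M̃ (y + 2πm))⁻¹`, `c = a_n⁻¹`, `M̃ = M/N²`
(`|u_n^{η′}(p+l′)|² = Ur R m y`, `Δ^{η′}(p+l′) = N²·DeltaXir R M̃ (y + 2πm)`).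
[cite: King1986, (4.12)–(4.13) p.671] -/
def composedInvResc (c : ℝ) (R : ℕ) (Mt : ℝ) (y : Fin dd → ℝ) : ℝ :=
  c + ∑ m : Fin dd → Fin R, B4Strip.Ur R m y * (B4Strip.DeltaXir R Mt (B4Strip.shiftr R m y))⁻¹

/-- The composed inverse symbol is positive (the `m = 0` term alone is `≥ (4/π²)^d · Δ^{η′}(y)⁻¹ > 0`).
[cite: King1986, (4.12) p.671] -/
theorem composedInvResc_pos {c : ℝ} (hc : 0 ≤ c) {R : ℕ} [NeZero R] (hR : 1 ≤ R) {Mt : ℝ}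
    (hMt : 0 ≤ Mt) {y : Fin dd → ℝ} (hy : ∀ μ, |y μ| ≤ π) (hy0 : 0 < momSq y) :
    0 < composedInvResc c R Mt y := by
  unfold composedInvResc
  have hR0 : R ≠ 0 := by omega
  have hterm_nonneg : ∀ m : Fin dd → Fin R,
      0 ≤ B4Strip.Ur R m y * (B4Strip.DeltaXir R Mt (B4Strip.shiftr R m y))⁻¹ := fun m =>
    mul_nonneg (B4Strip.Ur_nonneg R m y) (inv_nonneg.mpr (B4Strip.DeltaXir_nonneg R Mt hMt _))
  -- the zero alias term is positive
  have hU0 : 0 < B4Strip.Ur R (fun _ => (0 : Fin R)) y :=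
    lt_of_lt_of_le (by positivity) (B4Strip.Ur_zero_ge R hR y hy)
  have hB0 : 0 < B4Strip.DeltaXir R Mt (B4Strip.shiftr R (fun _ => (0 : Fin R)) y) := by
    rw [shiftr_zero, DeltaXir_eq_latticeSymbol hR0]
    have hRinv : ((R : ℝ)⁻¹) ≠ 0 := inv_ne_zero (by exact_mod_cast hR0)
    have hyz : ∀ μ, |(R : ℝ)⁻¹ * y μ| ≤ π := by
      intro μ
      rw [abs_mul, abs_inv, Nat.abs_cast]
      have hR1 : (1 : ℝ) ≤ R := by exact_mod_cast hR
      calc (R : ℝ)⁻¹ * |y μ| ≤ 1 * |y μ| :=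
            mul_le_mul_of_nonneg_right (inv_le_one_of_one_le₀ hR1) (abs_nonneg _)
        _ ≤ π := by rw [one_mul]; exact hy μ
    have := latticeSymbol_ge_jordan hRinv Mt hyz
    have : 0 < 4 / π ^ 2 * momSq y := by positivity
    linarith
  have h0 : 0 < B4Strip.Ur R (fun _ => (0 : Fin R)) y
      * (B4Strip.DeltaXir R Mt (B4Strip.shiftr R (fun _ => (0 : Fin R)) y))⁻¹ :=
    mul_pos hU0 (inv_pos.mpr hB0)
  have hsum : B4Strip.Ur R (fun _ => (0 : Fin R)) y
      * (B4Strip.DeltaXir R Mt (B4Strip.shiftr R (fun _ => (0 : Fin R)) y))⁻¹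
      ≤ ∑ m : Fin dd → Fin R, B4Strip.Ur R m y * (B4Strip.DeltaXir R Mt (B4Strip.shiftr R m y))⁻¹ :=
    Finset.single_le_sum (fun m _ => hterm_nonneg m) (Finset.mem_univ _)
  linarith

/-- **King's Lemma 4.2, rescaled, with explicit constants.**  On the Brillouin zone `|y_μ| ≤ π`,
`y ≠ 0`, for `c ≥ 0`, `M̃ ≥ 0`, `R ≥ 1`:
`|N²D⁻¹(p) − (|y|² + M̃)⁻¹| = |composedInvResc c R M̃ y − (momSq y + M̃)⁻¹| ≤ c + π²/48 + 1/3`.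
The three printed ingredients: (4.7) for `Δ^{η′}` (constant `π²/48`), (4.15)
`1 − |u_n^{η′}(p)|² ≤ |y|²/12`, and the far-alias bound `Δ^{η′}(p+l′)⁻¹ ≤ N⁻²/4` summed with the
aliasing identity `Σ_m Ur R m y = 1`. [cite: King1986, Lemma 4.2 with (4.14)–(4.16) p.671] -/
theorem lemma42_resc {c : ℝ} (hc : 0 ≤ c) {R : ℕ} [NeZero R] (hR : 1 ≤ R) {Mt : ℝ} (hMt : 0 ≤ Mt)
    {y : Fin dd → ℝ} (hy : ∀ μ, |y μ| ≤ π) (hy0 : 0 < momSq y) :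
    |composedInvResc c R Mt y - (momSq y + Mt)⁻¹| ≤ c + π ^ 2 / 48 + 1 / 3 := by
  have hR0 : R ≠ 0 := by omega
  set U : (Fin dd → Fin R) → ℝ := fun m => B4Strip.Ur R m y with hUdef
  set B : (Fin dd → Fin R) → ℝ := fun m => B4Strip.DeltaXir R Mt (B4Strip.shiftr R m y) with hBdef
  set z : Fin dd → Fin R := fun _ => 0 with hzdef
  set Ref : ℝ := (momSq y + Mt)⁻¹ with hRef
  have hUnn : ∀ m, 0 ≤ U m := fun m => B4Strip.Ur_nonneg R m y
  have hBnn : ∀ m, 0 ≤ B m := fun m => B4Strip.DeltaXir_nonneg R Mt hMt _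
  -- Parseval: Σ U = 1, hence U z ≤ 1 and Σ_{m ≠ z} U m = 1 − U z
  have hPars : ∑ m, U m = 1 := sum_Ur_eq_one hR hy
  have hsplitU : U z + ∑ m ∈ Finset.univ.erase z, U m = 1 := by
    rw [Finset.add_sum_erase _ _ (Finset.mem_univ z)]; exact hPars
  have hrest_nonneg : 0 ≤ ∑ m ∈ Finset.univ.erase z, U m :=
    Finset.sum_nonneg fun m _ => hUnn m
  have hUz1 : U z ≤ 1 := by linarith
  -- (4.15): 1 − U z ≤ |y|²/12
  have h415 : 1 - U z ≤ momSq y / 12 := by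
    have := Ur_zero_ge_one_sub hR hy (R := R)
    simp only [hUdef, hzdef]; linarith
  -- the zero-alias value: B z = Δ^{η′}(y) rescaled = latticeSymbol R⁻¹ M̃ y, (4.7) with constant π²/48·R⁻²
  have hRinv : ((R : ℝ)⁻¹) ≠ 0 := inv_ne_zero (by exact_mod_cast hR0)
  have hyz : ∀ μ, |(R : ℝ)⁻¹ * y μ| ≤ π := by
    intro μ
    rw [abs_mul, abs_inv, Nat.abs_cast]
    have hR1 : (1 : ℝ) ≤ R := by exact_mod_cast hR
    calc (R : ℝ)⁻¹ * |y μ| ≤ 1 * |y μ| :=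
          mul_le_mul_of_nonneg_right (inv_le_one_of_one_le₀ hR1) (abs_nonneg _)
      _ ≤ π := by rw [one_mul]; exact hy μ
  have hBz : B z = latticeSymbol ((R : ℝ)⁻¹) Mt y := by
    simp only [hBdef, hzdef]; rw [shiftr_zero, DeltaXir_eq_latticeSymbol hR0]
  have h47 : |(B z)⁻¹ - Ref| ≤ π ^ 2 / 48 := by
    rw [hBz, hRef]
    have h := latticeSymbol_inv_sub_ref_le hRinv hMt hyz hy0
    have hR1 : (1 : ℝ) ≤ R := by exact_mod_cast hR
    have : π ^ 2 / 48 * ((R : ℝ)⁻¹) ^ 2 ≤ π ^ 2 / 48 := by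
      have h1 : ((R : ℝ)⁻¹) ^ 2 ≤ 1 := by
        have := inv_le_one_of_one_le₀ hR1
        have h0 : 0 ≤ (R : ℝ)⁻¹ := by positivity
        nlinarith
      nlinarith [Real.pi_pos]
    linarith
  -- far aliases: (B m)⁻¹ ≤ 1/4 for m ≠ z
  have hfar : ∀ m ∈ Finset.univ.erase z, U m * (B m)⁻¹ ≤ U m * (1 / 4) := by
    intro m hm
    have hne : m ≠ z := Finset.ne_of_mem_erase hm
    obtain ⟨μ, hμ⟩ : ∃ μ, (m μ : ℕ) ≠ 0 := by
      by_contra hall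
      push Not at hall
      apply hne
      funext μ
      exact Fin.ext (by simpa [hzdef] using hall μ)
    have h4 : 4 ≤ B m := DeltaXir_shift_ge_four hMt hy hμ
    have : (B m)⁻¹ ≤ 1 / 4 := by
      rw [one_div]; exact inv_anti₀ (by norm_num) h4
    exact mul_le_mul_of_nonneg_left this (hUnn m)
  have hfarSum : ∑ m ∈ Finset.univ.erase z, U m * (B m)⁻¹ ≤ (1 - U z) * (1 / 4) := by
    calc ∑ m ∈ Finset.univ.erase z, U m * (B m)⁻¹ ≤ ∑ m ∈ Finset.univ.erase z, U m * (1 / 4) :=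
          Finset.sum_le_sum hfar
      _ = (∑ m ∈ Finset.univ.erase z, U m) * (1 / 4) := by rw [Finset.sum_mul]
      _ = (1 - U z) * (1 / 4) := by rw [show ∑ m ∈ Finset.univ.erase z, U m = 1 - U z by linarith]
  have hfarSum_nonneg : 0 ≤ ∑ m ∈ Finset.univ.erase z, U m * (B m)⁻¹ :=
    Finset.sum_nonneg fun m _ => mul_nonneg (hUnn m) (inv_nonneg.mpr (hBnn m))
  -- decomposition of the composed symbol
  have hdecomp : composedInvResc c R Mt y = c + U z * (B z)⁻¹ + ∑ m ∈ Finset.univ.erase z, U m * (B m)⁻¹ := by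
    unfold composedInvResc
    rw [← Finset.add_sum_erase _ _ (Finset.mem_univ z)]
    simp only [hUdef, hBdef]
    ring
  -- the near term: U z·B z⁻¹ − Ref = U z (B z⁻¹ − Ref) − (1 − U z) Ref
  have hRef_nonneg : 0 ≤ Ref := by rw [hRef]; exact inv_nonneg.mpr (by linarith)
  have hRef_le : momSq y / 12 * Ref ≤ 1 / 12 := by
    rw [hRef]
    have hpos : 0 < momSq y + Mt := by linarith
    rw [← div_eq_mul_inv, div_le_iff₀ hpos]
    linarith
  have hnear : |U z * (B z)⁻¹ - Ref| ≤ π ^ 2 / 48 + 1 / 12 := by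
    have hid : U z * (B z)⁻¹ - Ref = U z * ((B z)⁻¹ - Ref) - (1 - U z) * Ref := by ring
    rw [hid]
    have h1 : |U z * ((B z)⁻¹ - Ref)| ≤ π ^ 2 / 48 := by
      rw [abs_mul, abs_of_nonneg (hUnn z)]
      calc U z * |(B z)⁻¹ - Ref| ≤ 1 * (π ^ 2 / 48) :=
            mul_le_mul hUz1 h47 (abs_nonneg _) zero_le_one
        _ = π ^ 2 / 48 := one_mul _
    have h2 : |(1 - U z) * Ref| ≤ 1 / 12 := by
      rw [abs_of_nonneg (mul_nonneg (by linarith) hRef_nonneg)]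
      calc (1 - U z) * Ref ≤ momSq y / 12 * Ref := mul_le_mul_of_nonneg_right h415 hRef_nonneg
        _ ≤ 1 / 12 := hRef_le
    calc |U z * ((B z)⁻¹ - Ref) - (1 - U z) * Ref|
        ≤ |U z * ((B z)⁻¹ - Ref)| + |(1 - U z) * Ref| := abs_sub _ _
      _ ≤ π ^ 2 / 48 + 1 / 12 := by linarith
  -- assemble
  rw [hdecomp]
  have hid2 : c + U z * (B z)⁻¹ + ∑ m ∈ Finset.univ.erase z, U m * (B m)⁻¹ - Ref
      = c + (U z * (B z)⁻¹ - Ref) + ∑ m ∈ Finset.univ.erase z, U m * (B m)⁻¹ := by ring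
  rw [hid2]
  have hUz0 : 0 ≤ U z := hUnn z
  calc |c + (U z * (B z)⁻¹ - Ref) + ∑ m ∈ Finset.univ.erase z, U m * (B m)⁻¹|
      ≤ |c + (U z * (B z)⁻¹ - Ref)| + |∑ m ∈ Finset.univ.erase z, U m * (B m)⁻¹| := abs_add_le _ _
    _ ≤ (|c| + |U z * (B z)⁻¹ - Ref|) + |∑ m ∈ Finset.univ.erase z, U m * (B m)⁻¹| := by
        gcongr; exact abs_add_le _ _
    _ ≤ (c + (π ^ 2 / 48 + 1 / 12)) + (1 - U z) * (1 / 4) := by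
        rw [abs_of_nonneg hc, abs_of_nonneg hfarSum_nonneg]
        gcongr
    _ ≤ c + π ^ 2 / 48 + 1 / 3 := by nlinarith

/-- The composed inverse symbol `D⁻¹(q)` of (4.12) itself, at an alias point `q` of the `η`-zone
(`|q_μ| ≤ πN`): `N⁻²·composedInvResc a_n⁻¹ R (M/N²) (q/N)`. [cite: King1986, (4.12) p.671] -/
def composedInv (aninv : ℝ) (N R : ℕ) (M : ℝ) (q : Fin dd → ℝ) : ℝ :=
  ((N : ℝ) ^ 2)⁻¹ * composedInvResc aninv R (M / (N : ℝ) ^ 2) (fun μ => q μ / N)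

/-- `|q|² = N²·|q/N|²`. [folklore] -/
theorem momSq_rescale {N : ℕ} (hN : N ≠ 0) (q : Fin dd → ℝ) :
    momSq q = (N : ℝ) ^ 2 * momSq (fun μ => q μ / N) := by
  unfold momSq
  rw [Finset.mul_sum]
  refine Finset.sum_congr rfl fun μ _ => ?_
  have hN' : (N : ℝ) ≠ 0 := by exact_mod_cast hN
  field_simp

/-- **King's Lemma 4.2 = (4.7) for the composed `D`, explicit constant**: for `N ≥ 1` (`= L^k`),
`R ≥ 1` (`= L^n`), `a_n⁻¹ ≥ 0`, `M ≥ 0` and an alias point `q ≠ 0` of the `η`-zone `|q_μ| ≤ πN`: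
`|D⁻¹(q) − (|q|² + M)⁻¹| ≤ (a_n⁻¹ + π²/48 + 1/3)·N⁻²` ("`≤ CL^{−2k}`", (4.16)).
[cite: King1986, Lemma 4.2 and (4.16) p.671] -/
theorem lemma42 {aninv : ℝ} (ha : 0 ≤ aninv) {N R : ℕ} (hN : 1 ≤ N) [NeZero R] (hR : 1 ≤ R)
    {M : ℝ} (hM : 0 ≤ M) {q : Fin dd → ℝ} (hq : ∀ μ, |q μ| ≤ π * N) (hq0 : 0 < momSq q) :
    |composedInv aninv N R M q - (momSq q + M)⁻¹| ≤ (aninv + π ^ 2 / 48 + 1 / 3) * ((N : ℝ) ^ 2)⁻¹ := by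
  have hN0 : N ≠ 0 := by omega
  have hN' : (0 : ℝ) < N := by exact_mod_cast (Nat.pos_of_ne_zero hN0)
  have hN2 : (0 : ℝ) < (N : ℝ) ^ 2 := by positivity
  set y : Fin dd → ℝ := fun μ => q μ / N with hydef
  have hy : ∀ μ, |y μ| ≤ π := by
    intro μ
    simp only [hydef]
    rw [abs_div, Nat.abs_cast, div_le_iff₀ hN']
    exact hq μ
  have hmom : momSq q = (N : ℝ) ^ 2 * momSq y := momSq_rescale hN0 q
  have hy0 : 0 < momSq y := by
    rcases (momSq_nonneg y).eq_or_lt with h | h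
    · exfalso; rw [hmom, ← h, mul_zero] at hq0; exact lt_irrefl _ hq0
    · exact h
  have hMt : 0 ≤ M / (N : ℝ) ^ 2 := by positivity
  have h := lemma42_resc ha hR hMt hy hy0 (R := R)
  -- unscale: (|q|²+M)⁻¹ = N⁻²·(|y|² + M/N²)⁻¹
  have href : (momSq q + M)⁻¹ = ((N : ℝ) ^ 2)⁻¹ * (momSq y + M / (N : ℝ) ^ 2)⁻¹ := by
    rw [hmom, ← mul_inv]
    congr 1
    field_simp
  unfold composedInv
  rw [href, ← mul_sub, abs_mul, abs_of_pos (inv_pos.mpr hN2), mul_comm]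
  exact mul_le_mul_of_nonneg_right h (inv_pos.mpr hN2).le

/-- `D⁻¹(q) > 0`, hence `D(q) > 0`. [cite: King1986, (4.12) p.671] -/
theorem composedInv_pos {aninv : ℝ} (ha : 0 ≤ aninv) {N R : ℕ} (hN : 1 ≤ N) [NeZero R]
    (hR : 1 ≤ R) {M : ℝ} (hM : 0 ≤ M) {q : Fin dd → ℝ} (hq : ∀ μ, |q μ| ≤ π * N)
    (hq0 : 0 < momSq q) : 0 < composedInv aninv N R M q := by
  have hN0 : N ≠ 0 := by omega
  have hN' : (0 : ℝ) < N := by exact_mod_cast (Nat.pos_of_ne_zero hN0)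
  have hN2 : (0 : ℝ) < (N : ℝ) ^ 2 := by positivity
  have hy : ∀ μ, |(fun μ => q μ / N) μ| ≤ π := by
    intro μ
    simp only
    rw [abs_div, Nat.abs_cast, div_le_iff₀ hN']
    exact hq μ
  have hmom : momSq q = (N : ℝ) ^ 2 * momSq (fun μ => q μ / N) := momSq_rescale hN0 q
  have hy0 : 0 < momSq (fun μ => q μ / (N : ℝ)) := by
    by_contra h
    push Not at h
    have : momSq q ≤ 0 := by rw [hmom]; nlinarith
    linarith
  unfold composedInv
  exact mul_pos (inv_pos.mpr hN2) (composedInvResc_pos ha hR (by positivity) hy hy0)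

/-! ## §3 Proposition 3.10 (3.91) / Lemma 4.3 with explicit constants, no analytic hypothesis -/

variable {ι : Type*}

/-- **King's (3.91)/(4.18), fully explicit.**  Outer data: a finite set `s` of alias indices with alias
points `q_i` of the `η = N⁻¹`-zone (`|q_{i,μ}| ≤ πN`, `q_i ≠ 0`) and weights `w_i ≥ 0`, `Σ w ≤ 1`
(= `|u_k^η(p′+l)|²`), a constant `a > 0` (= `a_k`); `A_i = Δ^η(q_i)` = `latticeSymbol N⁻¹ M q_i`,
`D_i = D(q_i)` the composed value (4.12) with refinement `R = L^n` and `a_n⁻¹ = aninv`.  Then the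
level-`k` symbol `Δ = (a⁻¹ + Σ w_iA_i⁻¹)⁻¹` and the composed symbol `Δ̄ = (a⁻¹ + Σ w_iD_i⁻¹)⁻¹` (= the
level-`(k+n)` symbol by the composition law) satisfy
`|Δ − Δ̄| ≤ 2a·(a_n⁻¹ + π²/48 + 1/3)·N⁻²·Δ` — i.e. "`|Δ^{(k)}(p′) − Δ^{(k+n)}(p′)| ≤ CL^{−2k}Δ^{(k)}(p′)`"
with `C = 2a_k(a_n⁻¹ + π²/48 + 1/3)`, `L^{−2k} = N⁻²`, uniformly in `n`, `d`, `M ≥ 0`, `p′`.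
[cite: King1986, Lemma 4.3 (4.18) p.672; Prop. 3.10 (3.91) p.669] -/
theorem prop310_rate {s : Finset ι} {a aninv M : ℝ} (ha : 0 < a) (haninv : 0 ≤ aninv) (hM : 0 ≤ M)
    {N R : ℕ} (hN : 1 ≤ N) [NeZero R] (hR : 1 ≤ R) {w : ι → ℝ} {q : ι → Fin dd → ℝ}
    (hw : ∀ i ∈ s, 0 ≤ w i) (hw1 : ∑ i ∈ s, w i ≤ 1)
    (hq : ∀ i ∈ s, ∀ μ, |q i μ| ≤ π * N) (hq0 : ∀ i ∈ s, 0 < momSq (q i)) :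
    |effSymbol s a w (fun i => latticeSymbol ((N : ℝ)⁻¹) M (q i))
        - effSymbol s a w (fun i => (composedInv aninv N R M (q i))⁻¹)|
      ≤ a * (2 * ((aninv + π ^ 2 / 48 + 1 / 3) * ((N : ℝ) ^ 2)⁻¹))
        * effSymbol s a w (fun i => latticeSymbol ((N : ℝ)⁻¹) M (q i)) := by
  have hN0 : N ≠ 0 := by omega
  have hN' : (0 : ℝ) < N := by exact_mod_cast (Nat.pos_of_ne_zero hN0)
  have hNinv : ((N : ℝ)⁻¹) ≠ 0 := inv_ne_zero hN'.ne'
  set θ₀ : ℝ := (aninv + π ^ 2 / 48 + 1 / 3) * ((N : ℝ) ^ 2)⁻¹ with hθ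
  have hθ0 : 0 ≤ θ₀ := by positivity
  -- zone hypothesis in the `η·q` form
  have hzone : ∀ i ∈ s, ∀ μ, |(N : ℝ)⁻¹ * q i μ| ≤ π := by
    intro i hi μ
    rw [abs_mul, abs_inv, Nat.abs_cast, inv_mul_le_iff₀ hN']
    calc |q i μ| ≤ π * N := hq i hi μ
      _ = (N : ℝ) * π := mul_comm _ _
  -- positivity of the A's and D's
  have hA : ∀ i ∈ s, 0 < latticeSymbol ((N : ℝ)⁻¹) M (q i) := by
    intro i hi
    have := latticeSymbol_ge_jordan hNinv M (hzone i hi)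
    have : 0 < 4 / π ^ 2 * momSq (q i) := by have := hq0 i hi; positivity
    linarith
  have hD : ∀ i ∈ s, 0 < (composedInv aninv N R M (q i))⁻¹ := fun i hi =>
    inv_pos.mpr (composedInv_pos haninv hN hR hM (hq i hi) (hq0 i hi))
  -- (4.7) for Δ^η with constant π²/48 · N⁻² ≤ θ₀
  have hAref : ∀ i ∈ s, |(latticeSymbol ((N : ℝ)⁻¹) M (q i))⁻¹ - (momSq (q i) + M)⁻¹| ≤ θ₀ := by
    intro i hi
    have h := latticeSymbol_inv_sub_ref_le hNinv hM (hzone i hi) (hq0 i hi)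
    rw [hθ]
    have : π ^ 2 / 48 * ((N : ℝ)⁻¹) ^ 2 ≤ (aninv + π ^ 2 / 48 + 1 / 3) * ((N : ℝ) ^ 2)⁻¹ := by
      rw [inv_pow]
      apply mul_le_mul_of_nonneg_right _ (by positivity)
      linarith
    linarith
  -- (4.7) for D: Lemma 4.2
  have hDref : ∀ i ∈ s, |((composedInv aninv N R M (q i))⁻¹)⁻¹ - (momSq (q i) + M)⁻¹| ≤ θ₀ := by
    intro i hi
    rw [inv_inv]
    exact lemma42 haninv hN hR hM (hq i hi) (hq0 i hi)
  exact abs_effSymbol_sub_le_of_ref ha hw hw1 hA hD hθ0 hAref hDref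

end Literature.MathematicalPhysics.QuantumFieldTheory.King1986

end
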